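import Summits.QuantumFields.YangMills.Theorems.NPointIsotropy.Negative.ModelBlindFalse
import Summits.QuantumFields.YangMills.Cruxes.NPointIsotropy.SketchIdeator3

/-!
# Crux triage (stmt-QuantumFields-11686, round 1, triager 1): the n-point band-limit lemma as filed
# by ideator 3 (`Sketch.AngularBandLimit`, card `entire-angle-band-limit`) is FALSE model-blind

The target is the EXACT declaration `Summit.QuantumFields.YangMills.Cruxes.NPointIsotropy.Sketch.AngularBandLimit`
of `Summits/QuantumFields/YangMills/Cruxes/NPointIsotropy/SketchIdeator3.lean` (imported, not copied), with its
auxiliaries `Sketch.IsPlanarRotation`, `Sketch.EightFrameRP`. It asserts, for EVERY off-diagonal test function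
`F`, that `θ ↦ 𝔖ₙ(R_θ · F)` is a trigonometric polynomial in `e^{4iθ}`.

Main result: `not_AngularBandLimit : ¬ Sketch.AngularBandLimit` (sorry-free; axioms propext,
Classical.choice, Quot.sound).

Witness against it: the standing disprover's junk family `junk` (`𝔖₀ = 1`, `𝔖₄ = J`, else `0`) of
`Theorems/NPointIsotropy/Negative/JunkFamily.lean`, which satisfies every hypothesis of the lemma
(E0', E3, translations, quarter-turn invariance, reflection positivity in all eight planar frames), and the
bump tensor `F₀` (bumps at `0, 10e₃, 10e₂, 10e₀`) of `ModelBlindFalse.lean`: `θ ↦ 𝔖₄(R_θ · F₀)` vanishes on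
the whole arc `1/2 < θ < 1` (the rotated fourth bump is off every coordinate axis, so no signed-permutation
image of the 7-plane pattern fits the support) while `Re 𝔖₄(F₀) > 0`; a trigonometric polynomial vanishing
on an interval vanishes identically (identity theorem for the entire function
`z ↦ Σ c_k e^{4ikz}`), contradiction.

MORAL for the line: the band-limit lever must be stated on planar-GENERIC supports (as ideator 2's
`EntireComplexAngle` does), and the passage "generic supports ⇒ all of ⁰𝒮" is exactly the step that needs
the Wilson-limit clause (regularity of `𝔖ₙ|⁰𝒮` across the exceptional set `𝔈ₙ`).
-/

noncomputable section

-- Mathlib's `SimplexCategory` instance `Fintype (Fin (x.len + 1))` matches `Fintype (Fin 4)` (tree-known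
-- workaround, as in the Negative files).
attribute [-instance] SimplexCategory.instFintypeToTypeOrderHomFinHAddNatLenOfNat

namespace Summit.QuantumFields.YangMills.Cruxes.NPointIsotropy.Triage

open scoped BigOperators ComplexConjugate InnerProductSpace
open MeasureTheory Filter Topology
open Literature.MathematicalPhysics.QuantumLattice Literature.MathematicalPhysics.AQFT
  Literature.MathematicalPhysics.QuantumFieldTheory
open Summit.QuantumFields.YangMills.Theorems.NPointIsotropy.Negative

/-! ## §1 The filed statements

`Sketch.IsPlanarRotation R θ` (det `1`, fixes `e₂, e₃`, `R e₀ = cos θ e₀ + sin θ e₁`), `Sketch.EightFrameRP S`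
(pull-back RP for the eight planar frames) and `Sketch.AngularBandLimit` are used by name from the imported
sketch module. -/

open Summit.QuantumFields.YangMills.Cruxes.NPointIsotropy.Sketch (IsPlanarRotation EightFrameRP AngularBandLimit)

/-! ## §2 Planar rotations by an arbitrary angle, as products of two mirrors -/

/-- The unit vector `cos θ e₀ + sin θ e₁`. -/
def fθ (θ : ℝ) : E4 := Real.cos θ • e 0 + Real.sin θ • e 1

theorem norm_fθ (θ : ℝ) : ‖fθ θ‖ = 1 := by
  have h : ‖fθ θ‖ ^ 2 = 1 := by
    rw [EuclideanSpace.norm_sq_eq]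
    simp [fθ, e, Fin.sum_univ_four]
  nlinarith [norm_nonneg (fθ θ)]

/-- Mirror exchanging `e₀` and `fθ θ`. -/
def ρθ (θ : ℝ) : E4 ≃ₗᵢ[ℝ] E4 := (ℝ ∙ (e 0 - fθ θ))ᗮ.reflection

/-- The rotation `R_θ = ρθ ∘ ρ₁`: `e₀ ↦ cos θ e₀ + sin θ e₁`, fixing `e₂, e₃`. -/
def Rθ (θ : ℝ) : E4 ≃ₗᵢ[ℝ] E4 := ρ₁.trans (ρθ θ)

theorem ρθ_e0 (θ : ℝ) : ρθ θ (e 0) = fθ θ := Submodule.reflection_sub (by rw [norm_e, norm_fθ])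

theorem ρθ_e2 (θ : ℝ) : ρθ θ (e 2) = e 2 :=
  reflection_fix (by simp [fθ, inner_sub_left, inner_add_left, real_inner_smul_left, inner_e_e])

theorem ρθ_e3 (θ : ℝ) : ρθ θ (e 3) = e 3 :=
  reflection_fix (by simp [fθ, inner_sub_left, inner_add_left, real_inner_smul_left, inner_e_e])

theorem Rθ_e0 (θ : ℝ) : Rθ θ (e 0) = fθ θ := by simp [Rθ, ρ₁_e0, ρθ_e0]

theorem Rθ_e2 (θ : ℝ) : Rθ θ (e 2) = e 2 := by simp [Rθ, ρ₁_e2, ρθ_e2]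

theorem Rθ_e3 (θ : ℝ) : Rθ θ (e 3) = e 3 := by simp [Rθ, ρ₁_e3, ρθ_e3]

/-- `det R_θ = 1` whenever `sin θ ≠ 0` (so that the second mirror is a genuine hyperplane reflection). -/
theorem Rθ_det {θ : ℝ} (hs : Real.sin θ ≠ 0) :
    LinearMap.det ((Rθ θ).toLinearEquiv : E4 →ₗ[ℝ] E4) = 1 := by
  have h1 : (e 1 - (-e 1) : E4) ≠ 0 := by
    intro h
    have := congrArg (fun v : E4 => v 1) h
    simp [e] at this
  have h2 : (e 0 - fθ θ : E4) ≠ 0 := by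
    intro h
    have := congrArg (fun v : E4 => v 1) h
    simp [e, fθ] at this
    exact hs this
  rw [Rθ, LinearIsometryEquiv.toLinearEquiv_trans, LinearEquiv.coe_trans, LinearMap.det_comp, ρ₁, ρθ,
    det_reflection_hyperplane h1, det_reflection_hyperplane h2]
  norm_num

theorem isPlanarRotation_Rθ {θ : ℝ} (hs : Real.sin θ ≠ 0) : IsPlanarRotation (Rθ θ) θ := by
  refine ⟨Rθ_det hs, ?_, ?_, ?_⟩
  · simpa [e] using Rθ_e2 θ
  · simpa [e] using Rθ_e3 θ
  · simpa [e, fθ] using Rθ_e0 θ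

theorem isPlanarRotation_refl : IsPlanarRotation (LinearIsometryEquiv.refl ℝ E4) 0 := by
  refine ⟨?_, rfl, rfl, ?_⟩
  · change LinearMap.det (LinearMap.id : E4 →ₗ[ℝ] E4) = 1
    exact LinearMap.det_id
  · simp

/-! ## §3 `𝔖₄(R_θ · F₀) = 0` on the arc `1/2 < θ < 1` -/

/-- The rotated centres. -/
theorem Rθ_ctr (θ : ℝ) (i : Fin 4) :
    Rθ θ (ctr i) = (![0, (10 : ℝ) • e 3, (10 : ℝ) • e 2, (10 : ℝ) • fθ θ] : Fin 4 → E4) i := by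
  fin_cases i <;> simp [ctr, Rθ_e0, Rθ_e2, Rθ_e3]

/-- Planar coordinates of the decisive difference of rotated centres. -/
theorem Rθ_ctr_sub {θ : ℝ} (hc : 1 / 5 ≤ Real.cos θ) (hs : 1 / 5 ≤ Real.sin θ) (i₀ : Fin 4) :
    let j₀ : Fin 4 := if i₀ = 3 then 0 else 3
    2 ≤ |(Rθ θ (ctr j₀)) 0 - (Rθ θ (ctr i₀)) 0| ∧ 2 ≤ |(Rθ θ (ctr j₀)) 1 - (Rθ θ (ctr i₀)) 1| := by
  intro j₀
  have hc' : 2 ≤ |10 * Real.cos θ| := by rw [abs_of_nonneg (by linarith)]; linarith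
  have hs' : 2 ≤ |10 * Real.sin θ| := by rw [abs_of_nonneg (by linarith)]; linarith
  have hc'' : 2 ≤ |-(10 * Real.cos θ)| := by rw [abs_neg]; exact hc'
  have hs'' : 2 ≤ |-(10 * Real.sin θ)| := by rw [abs_neg]; exact hs'
  fin_cases i₀ <;> simp [j₀, Rθ_ctr, fθ, e] <;> first
    | exact ⟨hc', hs'⟩
    | exact ⟨hc'', hs''⟩
    | (constructor <;> first | simpa using hc' | simpa using hs')

/-- Geometric core on the arc: no signed-permutation image of the 7-plane pattern fits the rotated
support. (Copy of `no_fit` with `R₀ ↦ R_θ`.) -/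
theorem no_fit_θ {θ : ℝ} (hc : 1 / 5 ≤ Real.cos θ) (hs : 1 / 5 ≤ Real.sin θ)
    (σ : Equiv.Perm (Fin 4)) (ε : Fin 4 → Bool) (π : Equiv.Perm (Fin 4)) (y : D7)
    (z : Fin 4 → E4) (hz : ∀ i, sp σ ε (A y (π i)) = Rθ θ (z i))
    (hball : ∀ i, z i ∈ Metric.ball (ctr i) 1) : False := by
  set i₀ : Fin 4 := π.symm 0 with hi₀
  have hπi₀ : π i₀ = 0 := by simp [hi₀]
  set j₀ : Fin 4 := if i₀ = 3 then 0 else 3 with hj₀def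
  have hj₀ : j₀ ≠ i₀ := by
    by_cases h : i₀ = 3
    · rw [hj₀def, if_pos h, h]; decide
    · rw [hj₀def, if_neg h]; exact fun h' => h h'.symm
  have hk0 : π j₀ ≠ 0 := fun h => hj₀ (π.injective (h.trans hπi₀.symm))
  obtain ⟨c, m, hcm⟩ := A_sub_axis y hk0
  have hw : Rθ θ (z j₀ - z i₀) = (c * sgn (ε m)) • EuclideanSpace.single (σ m) 1 := by
    rw [map_sub, ← hz j₀, ← hz i₀, hπi₀, ← map_sub, hcm, LinearIsometryEquiv.map_smul, sp_single,
      mul_one]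
    ext k; by_cases hk : k = σ m <;> simp [hk, mul_comm]
  have hd : ‖Rθ θ (z j₀ - z i₀) - Rθ θ (ctr j₀ - ctr i₀)‖ < 2 := by
    rw [← map_sub, LinearIsometryEquiv.norm_map]
    have h1 : ‖z j₀ - ctr j₀‖ < 1 := by simpa [dist_eq_norm] using hball j₀
    have h2 : ‖z i₀ - ctr i₀‖ < 1 := by simpa [dist_eq_norm] using hball i₀
    calc ‖z j₀ - z i₀ - (ctr j₀ - ctr i₀)‖ = ‖(z j₀ - ctr j₀) - (z i₀ - ctr i₀)‖ := by
          congr 1; abel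
      _ ≤ ‖z j₀ - ctr j₀‖ + ‖z i₀ - ctr i₀‖ := norm_sub_le _ _
      _ < 2 := by linarith
  obtain ⟨hd0, hd1⟩ := Rθ_ctr_sub hc hs i₀
  rw [← hj₀def] at hd0 hd1
  have hcoord : ∀ ℓ : Fin 4, |(Rθ θ (z j₀ - z i₀)) ℓ - ((Rθ θ (ctr j₀)) ℓ - (Rθ θ (ctr i₀)) ℓ)| < 2 := by
    intro ℓ
    have h1 := PiLp.norm_apply_le (Rθ θ (z j₀ - z i₀) - Rθ θ (ctr j₀ - ctr i₀)) ℓ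
    rw [Real.norm_eq_abs, PiLp.sub_apply] at h1
    have h2 := h1.trans_lt hd
    rwa [map_sub (Rθ θ) (ctr j₀) (ctr i₀), PiLp.sub_apply] at h2
  rw [hw] at hcoord
  by_cases hm : σ m = 0
  · have h1 := hcoord 1
    have hne : (1 : Fin 4) ≠ σ m := by rw [hm]; decide
    simp only [PiLp.smul_apply, PiLp.single_apply, if_neg hne, smul_eq_mul, mul_zero, zero_sub,
      abs_neg] at h1
    linarith
  · have h0 := hcoord 0
    have hne : (0 : Fin 4) ≠ σ m := fun h' => hm h'.symm
    simp only [PiLp.smul_apply, PiLp.single_apply, if_neg hne, smul_eq_mul, mul_zero, zero_sub,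
      abs_neg] at h0
    linarith

/-- `J (R_θ · F₀) = 0` on the arc. -/
theorem J_RθF₀ {θ : ℝ} (hc : 1 / 5 ≤ Real.cos θ) (hs : 1 / 5 ≤ Real.sin θ) :
    J (linActMulti (Rθ θ) F₀) = 0 := by
  rw [J_apply]
  refine Finset.sum_eq_zero fun g _ => Finset.sum_eq_zero fun π _ => ?_
  have hz : (fun y : D7 => (linActMulti (Rθ θ) F₀) (fun i => sp g.1 g.2 (A y (π i)))) = fun _ => 0 := by
    funext y
    rw [linActMulti_apply, F₀_apply]
    by_contra hne
    have hne' : f₀ (fun i => (Rθ θ).symm (sp g.1 g.2 (A y (π i)))) ≠ 0 := by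
      simpa using hne
    exact no_fit_θ hc hs g.1 g.2 π y _ (fun i => by simp) (f₀_ball hne')
  rw [hz]
  simp

/-- Trigonometric bounds on the arc `1/2 < θ < 1`: `cos θ ≥ 1/2`, `sin θ > 3/8`. -/
theorem cos_sin_arc {θ : ℝ} (h1 : 1 / 2 < θ) (h2 : θ < 1) :
    1 / 5 ≤ Real.cos θ ∧ 1 / 5 ≤ Real.sin θ := by
  constructor
  · have := Real.one_sub_sq_div_two_le_cos (x := θ)
    nlinarith
  · have h := Real.sin_gt_sub_cube (x := θ) (by linarith)
    have h0 : 0 ≤ θ := by linarith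
    have hθ3 : θ ^ 3 ≤ θ := by
      calc θ ^ 3 = θ * (θ * θ) := by ring
        _ ≤ θ * 1 := by
            apply mul_le_mul_of_nonneg_left _ h0
            nlinarith
        _ = θ := mul_one θ
    nlinarith

/-! ## §4 The quarter-turn hypothesis: a planar rotation by `π/2` permutes the signed axes -/

theorem isHyper_of_isPlanarRotation_pi_div_two {R : E4 ≃ₗᵢ[ℝ] E4}
    (h : IsPlanarRotation R (Real.pi / 2)) : IsHyper R := by
  obtain ⟨-, h2, h3, h0⟩ := h
  have h0' : R (e 0) = e 1 := by simpa [e] using h0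
  have h2' : R (e 2) = e 2 := by simpa [e] using h2
  have h3' : R (e 3) = e 3 := by simpa [e] using h3
  -- `R e₁` is a unit vector orthogonal to `e₁, e₂, e₃`, hence `± e₀`
  set v : E4 := R (e 1) with hv
  have hcoord : ∀ j : Fin 4, v j = ⟪v, e j⟫_ℝ := fun j => by
    simp [e, EuclideanSpace.inner_single_right]
  have hv1 : v 1 = 0 := by
    rw [hcoord, ← h0', hv, LinearIsometryEquiv.inner_map_map, inner_e_e]; simp
  have hv2 : v 2 = 0 := by
    rw [hcoord, ← h2', hv, LinearIsometryEquiv.inner_map_map, inner_e_e]; simp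
  have hv3 : v 3 = 0 := by
    rw [hcoord, ← h3', hv, LinearIsometryEquiv.inner_map_map, inner_e_e]; simp
  have hnorm : ‖v‖ = 1 := by rw [hv, LinearIsometryEquiv.norm_map, norm_e]
  have hv0 : v 0 ^ 2 = 1 := by
    have := EuclideanSpace.norm_sq_eq v
    rw [hnorm, Fin.sum_univ_four] at this
    simp [hv1, hv2, hv3] at this
    linarith
  have hcases : v 0 = 1 ∨ v 0 = -1 := by
    have : (v 0 - 1) * (v 0 + 1) = 0 := by nlinarith
    rcases mul_eq_zero.1 this with h | h
    · left; linarith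
    · right; linarith
  intro i
  fin_cases i
  · exact ⟨1, Or.inl (by simpa [e] using h0')⟩
  · refine ⟨0, ?_⟩
    rcases hcases with h | h
    · left
      show v = EuclideanSpace.single 0 1
      ext j; fin_cases j <;> simp [h, hv1, hv2, hv3]
    · right
      show v = -EuclideanSpace.single 0 1
      ext j; fin_cases j <;> simp [h, hv1, hv2, hv3]
  · exact ⟨2, Or.inl (by simpa [e] using h2')⟩
  · exact ⟨3, Or.inl (by simpa [e] using h3')⟩

/-! ## §5 A trigonometric polynomial vanishing on an interval vanishes identically -/

theorem trigPoly_eq_zero_of_vanish (N : ℕ) (c : ℤ → ℂ) (θ₀ δ : ℝ) (hδ : 0 < δ)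
    (h : ∀ θ : ℝ, |θ - θ₀| < δ →
      ∑ k ∈ Finset.Icc (-(N : ℤ)) N, c k * Complex.exp (4 * (k : ℂ) * (θ : ℂ) * Complex.I) = 0)
    (z : ℂ) :
    ∑ k ∈ Finset.Icc (-(N : ℤ)) N, c k * Complex.exp (4 * (k : ℂ) * z * Complex.I) = 0 := by
  set p : ℂ → ℂ := fun z => ∑ k ∈ Finset.Icc (-(N : ℤ)) N, c k * Complex.exp (4 * (k : ℂ) * z * Complex.I)
    with hp
  have hdiff : Differentiable ℂ p := by
    rw [hp]
    fun_prop
  have han : AnalyticOnNhd ℂ p Set.univ := fun w _ => hdiff.analyticAt w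
  have hfreq : ∃ᶠ w in 𝓝[≠] ((θ₀ : ℝ) : ℂ), p w = 0 := by
    rw [Filter.frequently_iff]
    intro U hU
    obtain ⟨ε, hε, hsub⟩ := Metric.mem_nhdsWithin_iff.1 hU
    set t : ℝ := min ε δ / 2 with ht
    have ht0 : 0 < t := by rw [ht]; positivity
    have htε : t < ε := by
      rw [ht]; have := min_le_left ε δ; linarith
    have htδ : t < δ := by
      rw [ht]; have := min_le_right ε δ; linarith
    refine ⟨((θ₀ + t : ℝ) : ℂ), hsub ⟨?_, ?_⟩, ?_⟩
    · rw [Metric.mem_ball, Complex.dist_eq, ← Complex.ofReal_sub, Complex.norm_real, Real.norm_eq_abs]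
      simpa [abs_of_pos ht0] using htε
    · simp only [Set.mem_compl_iff, Set.mem_singleton_iff, Complex.ofReal_inj]
      linarith
    · show p _ = 0
      rw [hp]
      exact h (θ₀ + t) (by simpa [abs_of_pos ht0] using htδ)
  have hzero := han.eqOn_zero_of_preconnected_of_frequently_eq_zero isPreconnected_univ
    (Set.mem_univ _) hfreq
  exact hzero (Set.mem_univ z)

/-! ## §6 The refutation -/

set_option maxRecDepth 8000 in
set_option maxHeartbeats 1600000 in
/-- **`AngularBandLimit` (as filed, over ALL off-diagonal `F`) is false.** (The raised recursion
depth/heartbeats only serve to compare two elaborations of `𝔖₄(R_θ·F₀)` differing in auxiliary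
instance-proof constants, as in `ModelBlindFalse.not_conclusionOf_junk`.) -/
theorem not_AngularBandLimit : ¬ AngularBandLimit := by
  intro hABL
  have hquarter : ∀ (R : E4 ≃ₗᵢ[ℝ] E4), IsPlanarRotation R (Real.pi / 2) →
      ∀ (n : ℕ) (F : SchwartzMap (Fin n → E4) ℂ), IsOffDiagonal F →
        junk n (linActMulti R F) = junk n F :=
    fun R hR n F _ => junk_hyper n (isHyper_of_isPlanarRotation_pi_div_two hR) F
  have hframes : EightFrameRP junk := fun R a b _ _ hR => junk_frame_rp R a b hR
  obtain ⟨C, hC⟩ := hABL junk junk_hasLinearGrowth junk_isSymmetric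
    (fun n a F _ => junk_translate n a F) hquarter hframes
  obtain ⟨N, c, -, hc⟩ := hC 4 F₀ F₀_isOffDiagonal
  -- on the arc 1/2 < θ < 1 the junk four-point function of the rotated bumps vanishes
  have hvan : ∀ θ : ℝ, |θ - 3 / 4| < 1 / 4 →
      ∑ k ∈ Finset.Icc (-(N : ℤ)) N, c k * Complex.exp (4 * (k : ℂ) * (θ : ℂ) * Complex.I) = 0 := by
    intro θ hθ
    obtain ⟨h1, h2⟩ := abs_sub_lt_iff.1 hθ
    obtain ⟨hcos, hsin⟩ := cos_sin_arc (θ := θ) (by linarith) (by linarith)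
    have hs0 : Real.sin θ ≠ 0 := by intro h0; rw [h0] at hsin; linarith
    rw [← hc (Rθ θ) θ (isPlanarRotation_Rθ hs0), junk_four]
    exact J_RθF₀ hcos hsin
  -- hence the trigonometric polynomial vanishes identically, in particular at θ = 0
  have h0 := trigPoly_eq_zero_of_vanish N c (3 / 4) (1 / 4) (by norm_num) hvan ((0 : ℝ) : ℂ)
  have hval := hc (LinearIsometryEquiv.refl ℝ E4) 0 isPlanarRotation_refl
  rw [linActMulti_refl, ContinuousLinearMap.id_apply] at hval
  have hzero : junk 4 F₀ = 0 := hval.trans h0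
  have := junk4_F₀_re_pos
  rw [hzero, Complex.zero_re] at this
  exact lt_irrefl _ this

end Summit.QuantumFields.YangMills.Cruxes.NPointIsotropy.Triage

end
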